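import Mathlib
import HarnessLib
import Summits.HubbardSuperconductivity.HubbardSuperconductivity.Theorems.ComplexGFFStiffnessHypALocalTwoPointFreeEnergyAt
import Summits.HubbardSuperconductivity.HubbardSuperconductivity.Theorems.ComplexGFFStiffnessHypALocalTwoPointSlotConversionLastScale

/-!
# Crux `HypALocalTwoPoint`, line `gnv` — the free energy of one [ABKM19] package from the planner's SLOTS:
# `N`-FREE constants `C₂, C₃` with both difference clauses at every height (census F1 residual, step 2/3)

Route `route-HubbardSuperconductivity-ComplexGFFStiffness`, crux item stmt-HubbardSuperconductivity-19155
(`HypALocalTwoPoint`), registered stub `stub_twoPointGivenZ` (⇐ `FreeEnergyBounds` ⇐ route children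
`F4Statement 4`, `H1bcStatement 4`, `F1Residual`).  `…FreeEnergyAt.exists_freeEnergy_of_package` gives, at
fixed `(L, N)` and under `h₀`-indexed `q`-regularity hypotheses with sizes `a₀ … l_II`, a free energy `fE` with
the representation data (0) and the two difference clauses (2), (3) of `FreeEnergyBounds` whose constants are
CLOSED-FORM expressions in `L`-level data and the sizes.  Here the hypotheses are discharged from the planner's
bundled vocabulary — one package `P : PackageData d` with its height-`N` data `Q : PackageAt P N M`, the nine
`q`-slots and the state slot with `N`-free sizes (`…SlotConversion`, `…SlotConversionLastScale`: composition
with the tuning map, sizes `· c_q`, `· c_q²`) — and the constants are bound BEFORE `∀ N`: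

* **`exists_freeEnergyConsts_of_slots`** — `∃ C₂ C₃, ∀ N M (Q : PackageAt P N M), ∃ fE, (0) ∧ (2)_{C₂} ∧ (3)_{C₃}`.

This is the `N`-uniformity of [ABKM19] Theorem 2.2 (difference form, `ι`-symmetric complex class) for ONE
package, conditional on the slots (hypotheses, not named facts).  All proved, no `sorry`, general `d`.  Honest
scope: a rung route (stiffness of a complex Gaussian gradient field); nothing about superconductivity in the
Hubbard model.

## References
* S. Adams, S. Buchholz, R. Kotecký, S. Müller, arXiv:1910.13564, Thm 2.2, Ch. 4 (4.4)–(4.12), Lemma 12.6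
  [AdamsBuchholzKoteckyMuller2019].
-/

noncomputable section

-- `Summit.<Summit>.<Problem>`: single-conjunct summit, the duplicate component is mandated (D-0017).
set_option linter.dupNamespace false

namespace Summit.HubbardSuperconductivity.HubbardSuperconductivity.Theorems.ComplexGFF

open scoped BigOperators ComplexConjugate
open Real Set Finset MeasureTheory
open Literature.MathematicalPhysics.StatisticalMechanics.GradientRG
open Literature.MathematicalPhysics.StatisticalMechanics.GradientFRD
  (fourierCoeff cExt cExt_of_mem IsElliptic IsUnitSymm InShell iterDiff supNorm conv ellOp isElliptic_one)
open Literature.MathematicalPhysics.StatisticalMechanics.TorusPolymer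
  (IsPolymer numBlocks blockOf boxCorner isPolymer_blockOf isConn_blockOf pcirc)
open Literature.Barriers.CriticalPhenomena.LongRangePhi4.Polymer (IsConn components)
open Literature.MathematicalPhysics.QuantumFieldTheory
open Literature.Dynamics.Hyperbolic

variable {d : ℕ}

set_option maxHeartbeats 3200000 in
/-- **The free energy of one package from the slots, with `N`-free constants** (module docstring): for a
package `P` with `0 < r`, `4 p_Φ ≤ 2^{d+2}`, `N`-free sizes of the nine `q`-slots and of the state slot at every
height, and parameters `η, κ, ε, ρ, ρ𝒦` in the contraction regime of [ABKM19] Ch. 12 (smallness (12.54)–(12.56)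
in the form `hsmallF`), there are constants `C₂, C₃` such that AT EVERY HEIGHT `N` there is `fE` with
(0) `fE K = log κ + |Λ|λ(x₀) + Log I(K, x₀)` for a tuned `ι`-seed `x₀` of every `ι`-admissible `K` of size `ρ𝒦`,
`‖I − 1‖ ≤ εη^N A⁻¹A_𝒫`; (2) `‖fE(K+U) − fE K‖ ≤ C₂|Λ|u₁`; (3) `‖Σ± fE‖ ≤ C₃|Λ|u₁u₂`.
[cite: AdamsBuchholzKoteckyMuller2019, Thm 2.2 / Lemma 12.6] -/
theorem exists_freeEnergyConsts_of_slots (P : PackageData d) [Fact (0 < P.h)] [Fact (0 < P.L)]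
    (hp4 : 4 * P.pT ≤ 2 ^ (d + 2)) (hr : 0 < P.r)
    -- the `N`-free sizes of the `q`-slots and of the state slot
    {aT bT lT aTT bTT lTT lT' φT φTT σ₂ : ℝ} (haT : 0 ≤ aT) (hbT : 0 ≤ bT) (hlT : 0 ≤ lT) (haTT : 0 ≤ aTT)
    (hbTT : 0 ≤ bTT) (hlTT : 0 ≤ lTT) (hlT' : 0 ≤ lT') (hφT : 0 ≤ φT) (hφTT : 0 ≤ φTT) (hσ₂ : 0 ≤ σ₂)
    (hslots : ∀ (N M : ℕ) [NeZero M] (Q : PackageAt P N M),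
        F4a P Q aT ∧ F4b P Q bT ∧ F4l P Q lT ∧ F4a2 P Q aTT ∧ F4b2 P Q bTT ∧ F4l2 P Q lTT ∧
          F4l' P Q lT' ∧ F4Φ2 P Q φT ∧ F4Φ22 P Q φTT)
    (hstate : ∀ (N M : ℕ) [NeZero M] (Q : PackageAt P N M), H1σ2 P Q σ₂)
    -- the contraction regime of Ch. 12
    {η κ ε ρ : ℝ} (hη : 0 < η) (hη1 : η ≤ 1)
    (hκ₁ : (3 / 4 : ℝ) * (η + (P.L : ℝ) ^ d * (pi2BoundConst d (((2 * P.R + 2 : ℕ) : ℝ) + ((d / 2 + 1 : ℕ) : ℝ)) * (P.A𝒫' * P.A⁻¹))) ≤ κ)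
    (hκ₂ : sigmaABKM d P.L P.R P.A P.A𝒫' P.r ≤ κ * η) (hκ : κ < 1)
    (hε : 0 ≤ ε) (hεr : 3 * ε ≤ P.r) (hερ : 3 * ε ≤ ρ) (hρ64 : ρ ≤ 1 / 64)
    (hqT₀ : 2 * (d : ℝ) ^ 2 / (((P.L ^ (d * 0) : ℕ) : ℝ) * (fieldWt P.h (P.L : ℝ) d 0 / (P.L : ℝ) ^ 0) ^ 2) * ρ ≤ P.T₀)
    (hqε : 2 * (d : ℝ) ^ 2 / (((P.L ^ (d * 0) : ℕ) : ℝ) * (fieldWt P.h (P.L : ℝ) d 0 / (P.L : ℝ) ^ 0) ^ 2) * ε ≤ 1 / 6)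
    -- the radius of the perturbations
    {ρ𝒦 : ℝ}
    (h𝒦small : (Real.exp (1 / 4) + 2 * Real.exp (3 / 8)) * (ρ𝒦 * Real.exp (fieldWt P.h (P.L : ℝ) d 0 / (P.L : ℝ) ^ 0)) * P.A ≤ 1 / 2)
    (h𝒦ε : Real.exp (1 / 4) * (ρ𝒦 * Real.exp (fieldWt P.h (P.L : ℝ) d 0 / (P.L : ℝ) ^ 0)) * P.A ≤ ε)
    -- the smallness (12.54)–(12.56)
    (hsmallF : max (16 * Real.exp (3 / 8) * (ρ𝒦 * Real.exp (fieldWt P.h (P.L : ℝ) d 0 / (P.L : ℝ) ^ 0)) * P.A)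
      (max (lT * (2 * (d : ℝ) ^ 2 / (((P.L ^ (d * 0) : ℕ) : ℝ) * (fieldWt P.h (P.L : ℝ) d 0 / (P.L : ℝ) ^ 0) ^ 2)) * ε / η)
        ((3 / 4 * (bT * (2 * (d : ℝ) ^ 2 / (((P.L ^ (d * 0) : ℕ) : ℝ) * (fieldWt P.h (P.L : ℝ) d 0 / (P.L : ℝ) ^ 0) ^ 2)))
          + aT * (2 * (d : ℝ) ^ 2 / (((P.L ^ (d * 0) : ℕ) : ℝ) * (fieldWt P.h (P.L : ℝ) d 0 / (P.L : ℝ) ^ 0) ^ 2))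
            * (η + ((P.L : ℝ) ^ d * (pi2BoundConst d (((2 * P.R + 2 : ℕ) : ℝ) + ((d / 2 + 1 : ℕ) : ℝ)) * (P.A𝒫' * P.A⁻¹)))
              + 2 * ρ * (bT * (2 * (d : ℝ) ^ 2 / (((P.L ^ (d * 0) : ℕ) : ℝ) * (fieldWt P.h (P.L : ℝ) d 0 / (P.L : ℝ) ^ 0) ^ 2))))) * ε))
      ≤ (1 - κ) / 2) :
    ∃ C₂ C₃ : ℝ, ∀ (N M : ℕ) [NeZero M] (Q : PackageAt P N M),
      ∃ fE : ((Fin d → ℝ) → ℂ) → ℂ,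
        (∀ K : (Fin d → ℝ) → ℂ, ContDiff ℝ P.r₀ K →
          (∀ s, s ≤ P.r₀ → ∀ z : Fin d → ℝ, ‖iteratedFDeriv ℝ s K z‖ ≤ ρ𝒦 * Real.exp ((∑ i, z i ^ 2) / 4)) →
          (∀ z, K (-z) = (starRingEnd ℂ) (K z)) →
          ∃ x₀ : HamSpace ℂ d (fieldWt P.h (P.L : ℝ) d 0) ((P.L : ℝ) ^ 0) (P.L ^ (d * 0)),
            IsIotaHam (HamSpace.toHam x₀) ∧ ‖x₀‖ ≤ ρ ∧
            ‖(∫ φ, pcirc 1 (fun Y => expNegH (HamSpace.toHam x₀) Y φ)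
              (fun X => initKH K (HamSpace.toHam x₀) X φ) Finset.univ
            ∂(tailMeasure (fun jj => Q.𝒞 ((1 : Matrix (Fin d) (Fin d) ℝ) + hamQuadForm (HamSpace.toHam x₀)) jj) N N))
                - 1‖ ≤ ε * η ^ N * P.A⁻¹ * P.A𝒫' ∧
            fE K = ((((Real.log (formChangeConst (M := M) (1 : Matrix (Fin d) (Fin d) ℝ)
                (1 + hamQuadForm (HamSpace.toHam x₀)))) : ℝ) : ℂ)
              + (Fintype.card (Fin d → ZMod M) : ℂ) * (HamSpace.toHam x₀) (Sum.inl ())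
              + Complex.log (∫ φ, pcirc 1 (fun Y => expNegH (HamSpace.toHam x₀) Y φ)
                (fun X => initKH K (HamSpace.toHam x₀) X φ) Finset.univ
              ∂(tailMeasure (fun jj => Q.𝒞 ((1 : Matrix (Fin d) (Fin d) ℝ) + hamQuadForm (HamSpace.toHam x₀)) jj) N N)))) ∧
        (∀ (K U : (Fin d → ℝ) → ℂ) (u₁ : ℝ),
          ContDiff ℝ P.r₀ K →
          (∀ s, s ≤ P.r₀ → ∀ z : Fin d → ℝ, ‖iteratedFDeriv ℝ s K z‖ ≤ ρ𝒦 * Real.exp ((∑ i, z i ^ 2) / 4)) →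
          (∀ z, K (-z) = (starRingEnd ℂ) (K z)) →
          ContDiff ℝ P.r₀ U →
          (∀ s, s ≤ P.r₀ → ∀ z : Fin d → ℝ,
            ‖iteratedFDeriv ℝ s (fun z => K z + U z) z‖ ≤ ρ𝒦 * Real.exp ((∑ i, z i ^ 2) / 4)) →
          (∀ z, (fun z => K z + U z) (-z) = (starRingEnd ℂ) ((fun z => K z + U z) z)) →
          (∀ s, s ≤ P.r₀ → ∀ z : Fin d → ℝ, ‖iteratedFDeriv ℝ s U z‖ ≤ u₁ * Real.exp ((∑ i, z i ^ 2) / 4)) →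
          0 ≤ u₁ →
          Real.exp (1 / 4) * ((ρ𝒦 + u₁) * Real.exp (fieldWt P.h (P.L : ℝ) d 0 / (P.L : ℝ) ^ 0)) * P.A ≤ 1 / 2 →
          ‖fE (fun z => K z + U z) - fE K‖ ≤ C₂ * (Fintype.card (Fin d → ZMod M) : ℝ) * u₁) ∧
        (∀ (K U V : (Fin d → ℝ) → ℂ) (u₁ u₂ : ℝ),
          ContDiff ℝ P.r₀ K → ContDiff ℝ P.r₀ U → ContDiff ℝ P.r₀ V →
          (∀ s, s ≤ P.r₀ → ∀ z : Fin d → ℝ, ‖iteratedFDeriv ℝ s K z‖ ≤ ρ𝒦 * Real.exp ((∑ i, z i ^ 2) / 4)) →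
          (∀ s, s ≤ P.r₀ → ∀ z : Fin d → ℝ,
            ‖iteratedFDeriv ℝ s (fun z => K z + U z) z‖ ≤ ρ𝒦 * Real.exp ((∑ i, z i ^ 2) / 4)) →
          (∀ s, s ≤ P.r₀ → ∀ z : Fin d → ℝ,
            ‖iteratedFDeriv ℝ s (fun z => K z + V z) z‖ ≤ ρ𝒦 * Real.exp ((∑ i, z i ^ 2) / 4)) →
          (∀ s, s ≤ P.r₀ → ∀ z : Fin d → ℝ,
            ‖iteratedFDeriv ℝ s (fun z => K z + U z + V z) z‖ ≤ ρ𝒦 * Real.exp ((∑ i, z i ^ 2) / 4)) →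
          (∀ z, K (-z) = (starRingEnd ℂ) (K z)) →
          (∀ z, (fun z => K z + U z) (-z) = (starRingEnd ℂ) ((fun z => K z + U z) z)) →
          (∀ z, (fun z => K z + V z) (-z) = (starRingEnd ℂ) ((fun z => K z + V z) z)) →
          (∀ z, (fun z => K z + U z + V z) (-z) = (starRingEnd ℂ) ((fun z => K z + U z + V z) z)) →
          (∀ s, s ≤ P.r₀ → ∀ z : Fin d → ℝ, ‖iteratedFDeriv ℝ s U z‖ ≤ u₁ * Real.exp ((∑ i, z i ^ 2) / 4)) →
          (∀ s, s ≤ P.r₀ → ∀ z : Fin d → ℝ, ‖iteratedFDeriv ℝ s V z‖ ≤ u₂ * Real.exp ((∑ i, z i ^ 2) / 4)) →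
          0 ≤ u₁ → 0 ≤ u₂ →
          (Real.exp (1 / 4) + 16 * Real.exp (3 / 8) * (2 * ρ) + 16 * Real.exp (3 / 8) * (2 * ρ)
            + 256 * Real.exp (1 / 4) * (2 * ρ) * (2 * ρ)) *
              ((ρ𝒦 + u₁ + u₂) * Real.exp (fieldWt P.h (P.L : ℝ) d 0 / (P.L : ℝ) ^ 0)) * P.A ≤ 1 / 2 →
          ‖fE (fun z => K z + U z + V z) - fE (fun z => K z + U z) - fE (fun z => K z + V z) + fE K‖
            ≤ C₃ * (Fintype.card (Fin d → ZMod M) : ℝ) * u₁ * u₂) := by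
  have hρ0 : 0 ≤ ρ := by linarith
  have hcq0 : (0 : ℝ) ≤
      2 * (d : ℝ) ^ 2 / (((P.L ^ (d * 0) : ℕ) : ℝ) * (fieldWt P.h (P.L : ℝ) d 0 / (P.L : ℝ) ^ 0) ^ 2) := by
    positivity
  have key := fun (N M : ℕ) (_i : NeZero M) (Q : PackageAt P N M) =>
    exists_freeEnergy_of_package (d := d) (M := M) (L := P.L) (N := N) (Mord := P.Mord) (R := P.R)
      (n := P.n) (ñ := P.ñ) (θbar := P.θbar) (lam := P.lam) (μ := P.μ) (δ₁ := P.δ₁) (δ₀ := P.δ₀)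
      (A𝒫 := P.A𝒫) (𝒞 := Q.𝒞) (Mc := Q.Mc) (Cα := P.Cα) (c := P.c) (C := P.C) (Cℓ := P.Cℓ) (h := P.h)
      P.hd P.hMord P.hMR P.hLodd P.hL P.hR2 Q.hM P.hθbar P.hlam P.hn P.hn2 P.hnñ P.hc P.hC1 Q.hallA Q.hB
      P.hp P.hpM P.hr₀ P.hδ₀ P.hδ₁ P.hh0 P.hh2 P.hθ0 P.hθ P.hT₀ P.hKT₀ P.hA𝒫' P.hA1 P.hA𝒫A P.hsmall
      P.hr0 P.hr P.hv P.hωA P.hc3A P.hc2A hη hη1 hκ₁ hκ₂ hκ hε hεr hερ hρ64 hp4 hqT₀ hqε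
      h𝒦small h𝒦ε _ rfl _ rfl _ rfl _ rfl
      (a₀ := aT * (2 * (d : ℝ) ^ 2 / (((P.L ^ (d * 0) : ℕ) : ℝ) * (fieldWt P.h (P.L : ℝ) d 0 / (P.L : ℝ) ^ 0) ^ 2)))
      (b₀ := bT * (2 * (d : ℝ) ^ 2 / (((P.L ^ (d * 0) : ℕ) : ℝ) * (fieldWt P.h (P.L : ℝ) d 0 / (P.L : ℝ) ^ 0) ^ 2)))
      (l₀ := lT * (2 * (d : ℝ) ^ 2 / (((P.L ^ (d * 0) : ℕ) : ℝ) * (fieldWt P.h (P.L : ℝ) d 0 / (P.L : ℝ) ^ 0) ^ 2)))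
      (a₀₀ := aTT * (2 * (d : ℝ) ^ 2 / (((P.L ^ (d * 0) : ℕ) : ℝ) * (fieldWt P.h (P.L : ℝ) d 0 / (P.L : ℝ) ^ 0) ^ 2)) ^ 2)
      (b₀₀ := bTT * (2 * (d : ℝ) ^ 2 / (((P.L ^ (d * 0) : ℕ) : ℝ) * (fieldWt P.h (P.L : ℝ) d 0 / (P.L : ℝ) ^ 0) ^ 2)) ^ 2)
      (l₀₀ := lTT * (2 * (d : ℝ) ^ 2 / (((P.L ^ (d * 0) : ℕ) : ℝ) * (fieldWt P.h (P.L : ℝ) d 0 / (P.L : ℝ) ^ 0) ^ 2)) ^ 2)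
      (l₀' := lT' * (2 * (d : ℝ) ^ 2 / (((P.L ^ (d * 0) : ℕ) : ℝ) * (fieldWt P.h (P.L : ℝ) d 0 / (P.L : ℝ) ^ 0) ^ 2)))
      (σ₂ := σ₂)
      (lI := φT * (2 * (d : ℝ) ^ 2 / (((P.L ^ (d * 0) : ℕ) : ℝ) * (fieldWt P.h (P.L : ℝ) d 0 / (P.L : ℝ) ^ 0) ^ 2)))
      (lI' := φT * (2 * (d : ℝ) ^ 2 / (((P.L ^ (d * 0) : ℕ) : ℝ) * (fieldWt P.h (P.L : ℝ) d 0 / (P.L : ℝ) ^ 0) ^ 2)))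
      (lII := φTT * (2 * (d : ℝ) ^ 2 / (((P.L ^ (d * 0) : ℕ) : ℝ) * (fieldWt P.h (P.L : ℝ) d 0 / (P.L : ℝ) ^ 0) ^ 2)) ^ 2)
      (mul_nonneg haT hcq0) (mul_nonneg hbT hcq0) (mul_nonneg hlT hcq0) (mul_nonneg haTT (sq_nonneg _))
      (mul_nonneg hbTT (sq_nonneg _)) (mul_nonneg hlTT (sq_nonneg _)) (mul_nonneg hlT' hcq0) hσ₂
      (mul_nonneg hφT hcq0) (mul_nonneg hφT hcq0) (mul_nonneg hφTT (sq_nonneg _))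
      (stepA_sub_le_of_F4a P Q haT hρ0 hqT₀ (hslots N M Q).1)
      (stepB_sub_le_of_F4b P Q hbT hρ0 hqT₀ (hslots N M Q).2.1)
      (stepS_sub_of_F4l P Q hlT hρ0 hqT₀ (hslots N M Q).2.2.1)
      (stepA_secondDiff_le_of_F4a2 P Q haTT hρ0 hqT₀ (hslots N M Q).2.2.2.1)
      (stepB_secondDiff_le_of_F4b2 P Q hbTT hρ0 hqT₀ (hslots N M Q).2.2.2.2.1)
      (stepS_secondDiff_of_F4l2 P Q hlTT hρ0 hqT₀ (hslots N M Q).2.2.2.2.2.1)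
      (stepS_sub_sub_of_F4l' P Q hlT' hρ0 hqT₀ (hslots N M Q).2.2.2.2.2.2.1)
      (stepS_stateSecondDiff_of_H1σ2 P Q hρ0 hqT₀ (hstate N M Q))
      (lastScale_sub_le_of_F4Φ2 P Q hφT hρ0 hqT₀ (hslots N M Q).2.2.2.2.2.2.2.1)
      (lastScale_sub_sub_le_of_F4Φ2 P Q hφT hr hρ0 hqT₀ (hslots N M Q).2.2.2.2.2.2.2.1)
      (lastScale_secondDiff_le_of_F4Φ22 P Q hφTT hρ0 hqT₀ (hslots N M Q).2.2.2.2.2.2.2.2)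
      hsmallF
  exact ⟨_, _, fun N M _i Q => key N M _i Q⟩

end Summit.HubbardSuperconductivity.HubbardSuperconductivity.Theorems.ComplexGFF

end
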